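import Mathlib
import Literature.RingTheory.RegularLocalRing.SopRegular
import HarnessLib

/-!
# Colon capturing, step (a): a prefix of a system of parameters inside a prime

For a regular local ring `S` of dimension `n` and a prime `Q` of `S` with `dim S/Q = d` there are
`n - d` elements `y₁, …, y_{n-d} ∈ Q` with `dim S/(y) = d` (so that `y`, followed by lifts of a
system of parameters of `S/Q`, is a system of parameters of `S`). This is the `y`-part of the
colon-capturing argument "F-rational ⇒ Cohen–Macaulay" (Hochster–Huneke 1994, Thm. 4.2 (c)) for
`R = S/Q`.

Proof. `S` is a catenary Noetherian local domain (`isDomain_of_isRegularLocalRing`,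
`isCatenaryRing_of_isRegularLocalRing`), so the dimension formula `ht Q + dim S/Q = dim S`
(`IsCatenaryRing.height_eq_height_add_height_map_quotientMk`) gives `ht Q = n - d =: h`. By the
converse of Krull's height theorem (`exists_spanRank_le_and_le_height_of_le_height`, i.e. prime
avoidance against the minimal primes of height `< h`) there is an ideal `J ≤ Q` generated by at
most `h` elements with `ht J ≥ h`; enumerate the generators (padded with zeros) as
`y : Fin h → S`. Then `dim S/(y) ≥ dim S/Q = d` along the surjection `S/(y) → S/Q`, and
`dim S/(y) ≤ n - h = d` because a chain of primes `P₀ < ⋯ < P_k` above `(y)` has `ht P₀ ≥ h` and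
`ht P₀ + k ≤ dim S`.
-/

-- single-problem summit: the doubled namespace component is forced
set_option linter.dupNamespace false

noncomputable section

open IsLocalRing Literature.AlgebraicGeometry.Resolution

namespace Summit.ResolutionOfSingularities.ResolutionOfSingularities.Theorems.FRationalResolution

/-- If `h ≤ ht J` (every prime containing `J` has height `≥ h`) and `dim S = n`, then
`dim S/J ≤ n - h`: a chain of primes of length `k` above `J` starts at a prime `P₀` of height
`≥ h`, and `ht P₀ + coht P₀ ≤ dim S`. -/
theorem colonCapturing_exists_prefix_ringKrullDim_quotient_le {S : Type*} [CommRing S]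
    (J : Ideal S) {n h : ℕ} (hn : ringKrullDim S = n) (hJ : (h : ℕ∞) ≤ J.height) :
    ringKrullDim (S ⧸ J) ≤ (n - h : ℕ) := by
  rw [ringKrullDim_quotient, Order.krullDim]
  refine iSup_le fun l => ?_
  have key : l.length ≤ n - h := by
    let P : PrimeSpectrum S := (l.head).1
    haveI : Nonempty (PrimeSpectrum S) := ⟨P⟩
    have hJP : J ≤ P.asIdeal := fun x hx => l.head.2 hx
    have h1 : (h : ℕ∞) ≤ Order.height P := by
      rw [← PrimeSpectrum.height_eq_orderHeight]
      exact hJ.trans (Ideal.height_mono hJP)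
    have h2 : (l.length : ℕ∞) ≤ Order.coheight P :=
      (Order.length_le_coheight_head (p := l)).trans
        (Order.coheight_le_coheight_apply_of_strictMono
          (fun x : PrimeSpectrum.zeroLocus (R := S) (J : Set S) => x.1) (fun _ _ hlt => hlt)
          l.head)
    have h3 : Order.height P + Order.coheight P ≤ (n : ℕ∞) := by
      have e : ((⨆ a : PrimeSpectrum S, Order.height a + Order.coheight a : ℕ∞) : WithBot ℕ∞) =
          n := by
        rw [← Order.krullDim_eq_iSup_height_add_coheight_of_nonempty]
        exact hn
      have e' : (⨆ a : PrimeSpectrum S, Order.height a + Order.coheight a) = (n : ℕ∞) := by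
        exact_mod_cast e
      rw [← e']
      exact le_iSup (fun a : PrimeSpectrum S => Order.height a + Order.coheight a) P
    have h4 : ((h + l.length : ℕ) : ℕ∞) ≤ n := by
      push_cast
      exact (add_le_add h1 h2).trans h3
    have h5 : h + l.length ≤ n := by exact_mod_cast h4
    omega
  exact_mod_cast key

/-- **Colon capturing, step (a)** (towards Hochster–Huneke 1994, Thm. 4.2 (c)). In a regular local
ring `S` of dimension `n`, a prime `Q` with `dim S/Q = d` contains `n - d` elements `y` with
`dim S/(y) = d`. -/
theorem colonCapturing_exists_prefix (S : Type) [CommRing S] [IsRegularLocalRing S] (Q : Ideal S)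
    [Q.IsPrime] {n d : ℕ} (hn : ringKrullDim S = n) (hd : ringKrullDim (S ⧸ Q) = d) :
    ∃ y : Fin (n - d) → S, (∀ j, y j ∈ Q) ∧ ringKrullDim (S ⧸ Ideal.span (Set.range y)) = d := by
  classical
  haveI : IsDomain S := isDomain_of_isRegularLocalRing S
  have hQtop : Q ≠ ⊤ := ‹Q.IsPrime›.ne_top
  haveI : Nontrivial (S ⧸ Q) := Ideal.Quotient.nontrivial_iff.mpr hQtop
  haveI : IsLocalRing (S ⧸ Q) :=
    IsLocalRing.of_surjective' (Ideal.Quotient.mk Q) Ideal.Quotient.mk_surjective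
  -- (1) the dimension formula in the catenary domain `S`: `ht Q = n - d`
  have hcat := (isCatenaryRing_of_isRegularLocalRing S).height_eq_height_add_height_map_quotientMk
    (le_maximalIdeal hQtop)
  rw [map_maximalIdeal_of_surjective (Ideal.Quotient.mk Q) Ideal.Quotient.mk_surjective] at hcat
  have hmS : (maximalIdeal S).height = n := by
    have e := IsLocalRing.maximalIdeal_height_eq_ringKrullDim (R := S)
    rw [hn] at e
    exact_mod_cast e
  have hmQ : (maximalIdeal (S ⧸ Q)).height = d := by
    have e := IsLocalRing.maximalIdeal_height_eq_ringKrullDim (R := S ⧸ Q)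
    rw [hd] at e
    exact_mod_cast e
  obtain ⟨h, hQh⟩ := ENat.ne_top_iff_exists.mp (Ideal.height_ne_top hQtop)
  rw [hmS, hmQ, ← hQh] at hcat
  have hsum : n = h + d := by exact_mod_cast hcat
  obtain rfl : h = n - d := by omega
  -- (2) an ideal `J ≤ Q` generated by at most `n - d` elements with `ht J ≥ n - d`
  obtain ⟨J, hJQ, hJr, hJh⟩ := exists_spanRank_le_and_le_height_of_le_height Q (n - d) hQh.le
  have hJfg : J.FG := IsNoetherian.noetherian J
  obtain ⟨s, hscard, hsJ⟩ := Submodule.FG.exists_span_finset_card_eq_spanFinrank hJfg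
  have hsk : s.card ≤ n - d := by
    rw [hscard]
    exact (Submodule.FG.spanRank_le_iff hJfg (n - d)).mp hJr
  have hsJ' : (s : Set S) ⊆ J := by
    rw [← hsJ]
    exact Submodule.subset_span
  -- (3) enumerate the generators, padded with zeros
  let e : Fin s.card ≃ {x // x ∈ s} := s.equivFin.symm
  let y : Fin (n - d) → S := fun i => if hi : (i : ℕ) < s.card then (e ⟨i, hi⟩ : S) else 0
  have hyQ : ∀ j, y j ∈ Q := by
    intro j
    by_cases hj : (j : ℕ) < s.card
    · simp only [y, dif_pos hj]
      exact hJQ (hsJ' (e ⟨j, hj⟩).2)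
    · simp only [y, dif_neg hj]
      exact Q.zero_mem
  have hsy : (s : Set S) ⊆ Set.range y := by
    intro x hx
    refine ⟨Fin.castLE hsk (e.symm ⟨x, hx⟩), ?_⟩
    have hlt : ((Fin.castLE hsk (e.symm ⟨x, hx⟩) : Fin (n - d)) : ℕ) < s.card := by
      rw [Fin.val_castLE]
      exact (e.symm ⟨x, hx⟩).2
    have hidx : (⟨((Fin.castLE hsk (e.symm ⟨x, hx⟩) : Fin (n - d)) : ℕ), hlt⟩ : Fin s.card) =
        e.symm ⟨x, hx⟩ := Fin.ext (by simp only [Fin.val_castLE])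
    simp only [y, dif_pos hlt, hidx, Equiv.apply_symm_apply]
  have hJy : J ≤ Ideal.span (Set.range y) := by
    rw [← hsJ]
    exact Submodule.span_mono hsy
  have hyQ' : Ideal.span (Set.range y) ≤ Q := by
    rw [Ideal.span_le]
    rintro _ ⟨j, rfl⟩
    exact hyQ j
  refine ⟨y, hyQ, le_antisymm ?_ ?_⟩
  · -- `dim S/(y) ≤ n - (n - d) = d`
    have hle := colonCapturing_exists_prefix_ringKrullDim_quotient_le (Ideal.span (Set.range y)) hn
      (hJh.trans (Ideal.height_mono hJy))
    have hnd : n - (n - d) = d := by omega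
    rw [hnd] at hle
    exact hle
  · -- `d = dim S/Q ≤ dim S/(y)` along `S/(y) ↠ S/Q`
    rw [← hd]
    exact ringKrullDim_le_of_surjective (Ideal.Quotient.factor hyQ')
      (Ideal.Quotient.factor_surjective hyQ')

end Summit.ResolutionOfSingularities.ResolutionOfSingularities.Theorems.FRationalResolution
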